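import Literature.AlgebraicGeometry.Resolution.NearPointsPointCentreUnique
import Literature.AlgebraicGeometry.Resolution.NearPointsRational
import HarnessLib

/-!
# The near point over a point of a curve centre is unique (CoP1, Lemma 4.3 (4), in adapted coordinates)

Topic: `Literature/AlgebraicGeometry/Resolution`. [CoP1] = Cossart–Piltant, J. Algebra 320 (2008)
1051–1082, Lemma 4.3 (4), p. 8–9: "If `τ(x) = 1`, `Y` is a curve and `x′ ∈ q⁻¹(x)` is near `x`,
then `x′` is uniquely determined and rational over `x`. … we may now choose `(y₁, y₂, y₃)` in such a
way that `D_x = k(x).Y₂`, with `Y = (y₁, y₂)`. Similarly, the only point in `q⁻¹(x)` which may be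
very near `x` is the point `x′ := (y₁′ = y₁, y₂′ = y₂/y₁, y₃)`." The tree has rationality
(`IsBlowup.residue_comp_stalkMap_surjective_of_isNear`, `NearPointsRational.lean`) and uniqueness of the
near prime ON ONE CHART (`eq_of_near_of_near`). PROVED here, the SCHEME-LEVEL uniqueness in the
printed adapted coordinates: for the blowing up `π` of the regular locally Noetherian `X` along a
regular centre `Y ⊆ {ord = μ}` cut out at `x = π x′` by the pair `c = (c_j, c_l)` of regular
parameters, ADAPTED in the sense that every initial form of `J_x` with respect to `c` is a multiple of
`Y_l^μ` (the printed choice "`D_x = k(x)·Y₂`": the directrix is the class of `c_l`; at `τ(x) = 1`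
such a pair always exists), two near points over `x` are EQUAL. Mechanism (that of
`IsBlowup.eq_of_isNear_of_isNear_point`, Lemma 4.3 (3)): all points over `x` lie on one family of
charts (`IsBlowup.exists_chartFamily`); a near prime of the `c_l`-chart would make every initial form
a multiple of `(Y_j − a Y_l)^μ` (`exists_forall_mem_initialForms_eq_C_mul_pow`), incompatible with
`Y_l^μ`; so both points lie in the `c_j`-chart, where `eq_of_near_of_near` applies, and equal primes of
one chart are equal points.

* `IsBlowup.eq_of_isNear_of_isNear_curve_of_adapted` — **Lemma 4.3 (4), uniqueness** in adapted
  coordinates;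
* `IsBlowup.eq_of_isNear_of_isNear_curve` — the coordinate-free statement (shear `c_l ↦ c_l − ã c_j`
  to adapted coordinates first; the near point itself supplies `a`);
* `IsBlowup.isClosed_singleton_of_isNear_curve` — hence the near point over a closed point of the
  curve centre is a closed point (companion of `IsBlowup.isClosed_singleton_of_isNear_point`).

Gap T2b (`stub_T2b_eq_of_isNear_of_isNear_curve`) of the census `plan/inputs/F71-CENSUS-v0/v1.md`
(cell res-hironaka), closed with the stub's binders verbatim.

## Sources

* V. Cossart, O. Piltant, J. Algebra 320 (2008) 1051–1082, Lemma 4.3 (4) and its proof, pp. 8–9.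
  [CossartPiltant2008]
* H. Hironaka, Ann. of Math. 92 (1970) 327–334, Thm. 2 (near points lie on the directrix).
  [Hironaka1970]
-/

noncomputable section

open CategoryTheory CategoryTheory.Limits AlgebraicGeometry TopologicalSpace IsLocalRing MvPolynomial

namespace Literature.AlgebraicGeometry.Resolution

universe u

open Scheme.IdealSheafData

/-! ## A polynomial lemma -/

/-- `c₀ · Y_l^μ = c₀′ · (Y_j − a Y_l)^μ ≠ 0` is impossible for `l ≠ j`, `μ ≥ 1` (evaluate at
`Y_j = 1`, `Y_l = 0`). [folklore] -/
private theorem false_of_eq_C_mul_pow_of_eq_C_mul_sub_pow {k : Type*} [CommRing k] {j l : Fin 2}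
    (hl : l ≠ j) {μ : ℕ} (hμ : 1 ≤ μ) {G : MvPolynomial (Fin 2) k} (hG0 : G ≠ 0) {c₀ c₀' a : k}
    (h₁ : G = C c₀ * X l ^ μ) (h₂ : G = C c₀' * (X j - C a * X l) ^ μ) : False := by
  have hμ0 : μ ≠ 0 := by omega
  let φ : MvPolynomial (Fin 2) k →+* k := eval fun i => if i = j then 1 else 0
  have hφ₁ : φ G = 0 := by
    rw [h₁, map_mul, map_pow]
    simp [φ, hl, zero_pow hμ0]
  have hφ₂ : φ G = c₀' := by
    rw [h₂, map_mul, map_pow, map_sub, map_mul]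
    simp [φ, hl]
  have hc₀' : c₀' = 0 := by rw [← hφ₂, hφ₁]
  apply hG0
  rw [h₂, hc₀', map_zero, zero_mul]

/-- Two distinct indices of `Fin 2` different from a third one do not exist. [folklore] -/
private theorem Fin.eq_of_ne_of_ne {j j' l : Fin 2} (h₁ : j' ≠ j) (h₂ : l ≠ j) : j' = l := by
  revert j j' l
  decide

/-! ## Lemma 4.3 (4): uniqueness of the near point over a point of a curve centre -/

variable {X X' : Scheme.{u}} {π : X' ⟶ X}

/-- **[CoP1] Lemma 4.3 (4): the near point over a point of a curve centre is unique (adapted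
coordinates).** Let `X` be regular and locally Noetherian, `π` the blowing up along the regular centre
`Y ⊆ {ord J = μ}` (`μ ≥ 1`), `x = π x′ = π x″` a point of `Y` at which `𝓘_{Y,x} = (c_0, c_1)` for a
pair `c` that is part of a regular system of parameters, and suppose `c` is ADAPTED to the index `j`:
every initial form of `J_x` with respect to `c` is a multiple of `Y_l^μ`, `l ≠ j` ("`D_x = k(x)·Y₂`").
If `x′` and `x″` are both near (`ord J′ = μ` for the weak transform), then `x″ = x′`.
[cite: CossartPiltant2008, Lemma 4.3 (4)] [cite: Hironaka1970, Thm. 2] -/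
theorem IsBlowup.eq_of_isNear_of_isNear_curve_of_adapted [IsLocallyNoetherian X]
    [IsLocallyNoetherian X'] (hX : Scheme.IsRegular X) {Y : Closeds X}
    (hreg : Scheme.IsRegular (vanishingIdeal Y).subscheme) (hπ : IsBlowup π (vanishingIdeal Y))
    {J : X.IdealSheafData} {μ : ℕ} (hμ : 1 ≤ μ) (hY : ∀ y ∈ (Y : Set X), idealOrder J y = μ)
    {x' x'' : X'} [IsRegularLocalRing (X.presheaf.stalk (π x'))]
    {c : Fin 2 → X.presheaf.stalk (π x')} (hcr : IsRsopPart c)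
    (hcY : Ideal.span (Set.range c) = stalkIdeal (vanishingIdeal Y) (π x'))
    (j : Fin 2) {l : Fin 2} (hl : l ≠ j)
    (hadapt : ∀ G ∈ initialForms c (stalkIdeal J (π x')) μ,
      ∃ c₀ : ResidueField (X.presheaf.stalk (π x')), G = MvPolynomial.C c₀ * MvPolynomial.X l ^ μ)
    (hnear : IsNear π (vanishingIdeal Y) J μ x') (hnear' : IsNear π (vanishingIdeal Y) J μ x'')
    (he : π x'' = π x') : x'' = x' := by
  classical
  have hx : π x' ∈ (Y : Set X) := by
    rw [← coe_support_vanishingIdeal, SetLike.mem_coe, mem_support_iff_stalkIdeal_le, ← hcY]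
    exact hcr.span_range_le_maximalIdeal
  have hcm : ∀ i, c i ∈ maximalIdeal _ := hcr.mem_maximalIdeal
  have hcq : IsQuasiRegular c := by
    obtain ⟨e, z, hd, hz, hzc⟩ := hcr.exists_rsop
    have h := isQuasiRegular_rsop_comp hd z hz (Fin.castAdd e) (Fin.castAdd_injective 2 e)
    rwa [show z ∘ Fin.castAdd e = c from funext hzc] at h
  -- (1) a form `F` of degree `μ` with `F(c) ∈ J_x` and `F̄ ≠ 0` (`ord_x J = μ`, `J_x ⊆ P^μ`)
  have hJP : stalkIdeal J (π x') ≤ Ideal.span (Set.range c) ^ μ := by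
    rw [hcY, ← stalkIdeal_pow]
    exact stalkIdeal_mono (le_vanishingIdeal_pow_of_forall_idealOrder_eq hX hreg hY) _
  have hJnot : ¬ stalkIdeal J (π x') ≤ maximalIdeal _ ^ (μ + 1) := by
    rw [← le_idealOrder_iff, hY (π x') hx]
    exact_mod_cast Nat.not_succ_le_self μ
  obtain ⟨f, hfJ, hf'⟩ := Set.not_subset.mp hJnot
  obtain ⟨F, hF, hFf⟩ := exists_isHomogeneous_of_mem_span_pow c μ (hJP hfJ)
  have hF0 : MvPolynomial.map (residue _) F ≠ 0 :=
    map_residue_ne_zero_of_eval_not_mem_pow_succ c hcm hF (by rw [hFf]; exact hf')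
  have hFJ : MvPolynomial.eval c F ∈ stalkIdeal J (π x') := by
    rw [hFf]
    exact hfJ
  have hGmem : MvPolynomial.map (residue _) F ∈ initialForms c (stalkIdeal J (π x')) μ :=
    (mem_initialForms_iff c).mpr ⟨F, hF, hFJ, rfl⟩
  -- (2) near primes over `x` lie in the chart `j`: a near prime of the other chart makes the initial
  -- forms multiples of `(Y_j − a Y_l)^μ`, not of `Y_l^μ`
  have key : ∀ (j' : Fin 2) (𝔴 : Ideal (chartRing c j')) [𝔴.IsPrime],
      (maximalIdeal _).map (chartBase c j') ≤ 𝔴 →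
      (∀ F : MvPolynomial (Fin 2) (X.presheaf.stalk (π x')), F.IsHomogeneous μ →
        MvPolynomial.eval c F ∈ stalkIdeal J (π x') →
        (algebraMap (chartRing c j') (Localization.AtPrime 𝔴) :
            chartRing c j' →+* Localization.AtPrime 𝔴)
            (MvPolynomial.eval₂Hom (chartBase c j') (fun i => chartGen c j' i) F) ∈
          maximalIdeal (Localization.AtPrime 𝔴) ^ μ) → j' = j := by
    intro j' 𝔴 _ h𝔴 hnear𝔴
    by_contra hne
    have hjl : j' = l := Fin.eq_of_ne_of_ne hne hl
    subst hjl
    obtain ⟨a, ha⟩ :=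
      exists_forall_mem_initialForms_eq_C_mul_pow c j' (l := j) (Ne.symm hne) hcq hcm 𝔴 h𝔴 hμ
        hnear𝔴
    obtain ⟨c₀, hc₀⟩ := hadapt _ hGmem
    obtain ⟨c₀', hc₀'⟩ := ha _ hGmem
    exact false_of_eq_C_mul_pow_of_eq_C_mul_sub_pow hl hμ hF0 hc₀ hc₀'
  -- (3) one family of charts at `x` for `c`, through `x'` and `x''`
  obtain ⟨q, hqπ, hcov⟩ := hπ.exists_chartFamily (π x') c hcY
  obtain ⟨j₁, w₁, hqw₁, hiso₁⟩ := hcov x' rfl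
  obtain ⟨j₂, w₂, hqw₂, hiso₂⟩ := hcov x'' he
  haveI := hiso₁
  haveI := hiso₂
  obtain ⟨hw₁, hnear₁⟩ :=
    comap_eq_and_forall_near_forms_of_chart rfl hcY j₁ w₁ (q j₁) hqw₁ (hqπ j₁) hnear
  obtain ⟨hw₂, hnear₂⟩ :=
    comap_eq_and_forall_near_forms_of_chart he hcY j₂ w₂ (q j₂) hqw₂ (hqπ j₂) hnear'
  have hw₁' : (maximalIdeal _).map (chartBase c j₁) ≤ w₁.asIdeal := by
    rw [← hw₁]; exact Ideal.map_comap_le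
  have hw₂' : (maximalIdeal _).map (chartBase c j₂) ≤ w₂.asIdeal := by
    rw [← hw₂]; exact Ideal.map_comap_le
  have hj₁ : j₁ = j := key j₁ w₁.asIdeal hw₁' hnear₁
  have hj₂ : j₂ = j := key j₂ w₂.asIdeal hw₂' hnear₂
  have hl₁ : l ≠ j₁ := by rw [hj₁]; exact hl
  obtain rfl : j₂ = j₁ := hj₂.trans hj₁.symm
  -- (4) same chart: the chart-level uniqueness, and equal primes are equal points
  have heq : w₁.asIdeal = w₂.asIdeal :=
    eq_of_near_of_near c _ hl₁ hcq hcm hμ hF hF0 w₁.asIdeal w₂.asIdeal hw₁' hw₂'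
      (hnear₁ F hF hFJ) (hnear₂ F hF hFJ)
  have hw : w₁ = w₂ := PrimeSpectrum.ext heq
  rw [← hqw₂, ← hw, hqw₁]

/-! ## The coordinate-free statement: re-adapting the pair by a shear -/

/-- **Re-adapting the pair by a shear** ([CoP1] proof of Lemma 4.3 (4): "we may now choose
`(y₁, y₂, y₃)` in such a way that `D_x = k(x).Y₂`"): if every initial form of `J` with respect to
`c` is a multiple of `(Y_l − a Y_j)^μ`, `a` the residue of `ã`, then every initial form with
respect to the sheared pair `c̃ = (c_j, c_l − ã c_j)` is a multiple of `Y_l^μ` (substitute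
`Y_l ↦ Y_l + a Y_j`). [cite: CossartPiltant2008, Lemma 4.3 (4) (proof)] -/
theorem initialForms_shiftRsop_adapted {R : Type u} [CommRing R] [IsLocalRing R]
    (c : Fin 2 → R) (j : Fin 2) {l : Fin 2} (hl : l ≠ j) (ã : R) {J : Ideal R} {μ : ℕ}
    (ha : ∀ G ∈ initialForms c J μ, ∃ c₀ : ResidueField R,
      G = MvPolynomial.C c₀ * (MvPolynomial.X l - MvPolynomial.C (residue R ã) * MvPolynomial.X j) ^ μ) :
    ∀ G ∈ initialForms (shiftRsop c j fun _ => ã) J μ, ∃ c₀ : ResidueField R,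
      G = MvPolynomial.C c₀ * MvPolynomial.X l ^ μ := by
  classical
  intro G hG
  obtain ⟨F₂, hF₂, hF₂J, rfl⟩ := (mem_initialForms_iff (shiftRsop c j fun _ => ã)).mp hG
  have hij : ∀ i : Fin 2, i ≠ j → i = l := fun i hi => Fin.eq_of_ne_of_ne hi hl
  -- the substitution `Y_j ↦ Y_j`, `Y_i ↦ Y_i − ã Y_j` and its effect on `c`
  let θ : Fin 2 → MvPolynomial (Fin 2) R := fun i =>
    if i = j then MvPolynomial.X j else MvPolynomial.X i - MvPolynomial.C ã * MvPolynomial.X j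
  have hθc : ∀ i, MvPolynomial.eval c (θ i) = shiftRsop c j (fun _ => ã) i := by
    intro i
    by_cases hi : i = j
    · subst hi; simp [θ, shiftRsop_self]
    · simp [θ, hi, shiftRsop_of_ne c j _ hi]
  have hθhom : ∀ i, (θ i).IsHomogeneous 1 := by
    intro i
    by_cases hi : i = j
    · simp only [θ, if_pos hi]; exact MvPolynomial.isHomogeneous_X _ _
    · simp only [θ, if_neg hi]
      exact (MvPolynomial.isHomogeneous_X _ _).sub
        ((MvPolynomial.isHomogeneous_X _ _).C_mul _)
  set F : MvPolynomial (Fin 2) R := MvPolynomial.bind₁ θ F₂ with hFdef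
  have hF : F.IsHomogeneous μ := by
    have h := hF₂.aeval θ hθhom
    rwa [one_mul] at h
  have hFc : MvPolynomial.eval c F = MvPolynomial.eval (shiftRsop c j fun _ => ã) F₂ := by
    change MvPolynomial.eval₂Hom (RingHom.id R) c (MvPolynomial.bind₁ θ F₂) = _
    rw [MvPolynomial.eval₂Hom_bind₁]
    change MvPolynomial.eval (fun i => MvPolynomial.eval c (θ i)) F₂ = _
    simp_rw [hθc]
  have hFJ : MvPolynomial.eval c F ∈ J := by rw [hFc]; exact hF₂J
  obtain ⟨c₀, hc₀⟩ := ha _ ((mem_initialForms_iff c).mpr ⟨F, hF, hFJ, rfl⟩)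
  -- residues of the substitution and its inverse
  set a : ResidueField R := residue R ã with hadef
  let θk : Fin 2 → MvPolynomial (Fin 2) (ResidueField R) := fun i =>
    if i = j then MvPolynomial.X j else MvPolynomial.X i - MvPolynomial.C a * MvPolynomial.X j
  let θk' : Fin 2 → MvPolynomial (Fin 2) (ResidueField R) := fun i =>
    if i = j then MvPolynomial.X j else MvPolynomial.X i + MvPolynomial.C a * MvPolynomial.X j
  have hθk : ∀ i, MvPolynomial.map (residue R) (θ i) = θk i := by
    intro i
    by_cases hi : i = j
    · simp [θ, θk, hi]
    · simp [θ, θk, hi, hadef]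
  have hinv : ∀ i, MvPolynomial.bind₁ θk' (θk i) = MvPolynomial.X i := by
    intro i
    by_cases hi : i = j
    · subst hi; simp [θk, θk']
    · have hj : θk' j = MvPolynomial.X j := by simp [θk']
      have hi' : θk' i = MvPolynomial.X i + MvPolynomial.C a * MvPolynomial.X j := by simp [θk', hi]
      simp only [θk, if_neg hi, map_sub, map_mul, MvPolynomial.bind₁_X_right,
        MvPolynomial.bind₁_C_right, hj, hi']
      ring
  have hinv' : ∀ P : MvPolynomial (Fin 2) (ResidueField R),
      MvPolynomial.bind₁ θk' (MvPolynomial.bind₁ θk P) = P := by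
    intro P
    rw [MvPolynomial.bind₁_bind₁]
    have : (fun i => MvPolynomial.bind₁ θk' (θk i)) = MvPolynomial.X := funext hinv
    rw [this, MvPolynomial.bind₁_X_left]
    rfl
  -- `cl(F) = θ̄(cl(F₂))`, so `cl(F₂) = θ̄⁻¹(c₀ (Y_l − a Y_j)^μ) = c₀ Y_l^μ`
  have hmap : MvPolynomial.map (residue R) F = MvPolynomial.bind₁ θk (MvPolynomial.map (residue R) F₂) := by
    rw [hFdef, MvPolynomial.map_bind₁]
    have : (fun i => MvPolynomial.map (residue R) (θ i)) = θk := funext hθk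
    rw [this]
  refine ⟨c₀, ?_⟩
  calc MvPolynomial.map (residue R) F₂
      = MvPolynomial.bind₁ θk' (MvPolynomial.bind₁ θk (MvPolynomial.map (residue R) F₂)) :=
        (hinv' _).symm
    _ = MvPolynomial.bind₁ θk' (MvPolynomial.C c₀ *
          (MvPolynomial.X l - MvPolynomial.C a * MvPolynomial.X j) ^ μ) := by rw [← hmap, hc₀]
    _ = MvPolynomial.C c₀ * MvPolynomial.X l ^ μ := by
        have hj : θk' j = MvPolynomial.X j := by simp [θk']
        have hl' : θk' l = MvPolynomial.X l + MvPolynomial.C a * MvPolynomial.X j := by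
          simp [θk', hl]
        simp only [map_mul, map_pow, map_sub, MvPolynomial.bind₁_C_right,
          MvPolynomial.bind₁_X_right, hj, hl']
        ring

/-- The sheared pair `(c_j, c_l − ã c_j)` is again part of a regular system of parameters (it
generates the same ideal). [cite: CossartPiltant2008, Lemma 4.3 (4) (proof)] -/
theorem IsRsopPart.shiftRsop {R : Type u} [CommRing R] [IsLocalRing R] {c : Fin 2 → R}
    (hcr : IsRsopPart c) (j : Fin 2) (ã : R) : IsRsopPart (shiftRsop c j fun _ => ã) := by
  obtain ⟨hR, e, y, hdim, hsp⟩ := hcr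
  refine ⟨hR, e, y, hdim, ?_⟩
  rw [Ideal.span_union] at hsp ⊢
  rw [span_range_shiftRsop]
  exact hsp

/-- **[CoP1] Lemma 4.3 (4): the near point over a point of a curve centre is unique** (coordinate
free). Let `X` be regular and locally Noetherian, `π` the blowing up along the regular centre
`Y ⊆ {ord J = μ}` (`μ ≥ 1`), `x = π x′ = π x″` a point of `Y` at which `𝓘_{Y,x}` is generated by a
pair `c` that is part of a regular system of parameters (a curve through a threefold point, or the
generic point of a curve). If `x′` and `x″` are near, then `x″ = x′`: a chart presentation of `x′`
(`IsBlowup.exists_reesChart_stalk`) yields `a` with all initial forms multiples of `(Y_l − a Y_j)^μ`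
(`exists_forall_mem_initialForms_eq_C_mul_pow`); the sheared pair `(c_j, c_l − ã c_j)` is adapted
and `IsBlowup.eq_of_isNear_of_isNear_curve_of_adapted` applies. This is the statement
`stub_T2b_eq_of_isNear_of_isNear_curve` of the F-71 skeleton (cell res-hironaka).
[cite: CossartPiltant2008, Lemma 4.3 (4)] [cite: Hironaka1970, Thm. 2] -/
theorem IsBlowup.eq_of_isNear_of_isNear_curve [IsLocallyNoetherian X]
    [IsLocallyNoetherian X'] (hX : Scheme.IsRegular X) {Y : Closeds X}
    (hreg : Scheme.IsRegular (vanishingIdeal Y).subscheme) (hπ : IsBlowup π (vanishingIdeal Y))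
    {J : X.IdealSheafData} {μ : ℕ} (hμ : 1 ≤ μ) (hY : ∀ y ∈ (Y : Set X), idealOrder J y = μ)
    {x' x'' : X'} [IsRegularLocalRing (X.presheaf.stalk (π x'))]
    {c : Fin 2 → X.presheaf.stalk (π x')} (hcr : IsRsopPart c)
    (hcY : Ideal.span (Set.range c) = stalkIdeal (vanishingIdeal Y) (π x'))
    (hnear : IsNear π (vanishingIdeal Y) J μ x') (hnear' : IsNear π (vanishingIdeal Y) J μ x'')
    (he : π x'' = π x') : x'' = x' := by
  classical
  have hcm : ∀ i, c i ∈ maximalIdeal _ := hcr.mem_maximalIdeal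
  have hcq : IsQuasiRegular c := by
    obtain ⟨e, z, hd, hz, hzc⟩ := hcr.exists_rsop
    have h := isQuasiRegular_rsop_comp hd z hz (Fin.castAdd e) (Fin.castAdd_injective 2 e)
    rwa [show z ∘ Fin.castAdd e = c from funext hzc] at h
  -- a chart presentation of `x'` and the direction `a` of the initial forms
  obtain ⟨j, 𝔴, χ, hχ, hloc, h𝔴⟩ := hπ.exists_reesChart_stalk x' c hcY
  have h𝔴' : (maximalIdeal _).map (chartBase c j) ≤ 𝔴.asIdeal := by
    rw [← h𝔴]
    exact Ideal.map_comap_le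
  obtain ⟨l, hl⟩ : ∃ l : Fin 2, l ≠ j := ⟨j + 1, by fin_cases j <;> decide⟩
  have hnearF : ∀ F : MvPolynomial (Fin 2) (X.presheaf.stalk (π x')), F.IsHomogeneous μ →
      MvPolynomial.eval c F ∈ stalkIdeal J (π x') →
      (algebraMap (chartRing c j) (Localization.AtPrime 𝔴.asIdeal) :
          chartRing c j →+* Localization.AtPrime 𝔴.asIdeal)
          (MvPolynomial.eval₂Hom (chartBase c j) (fun i => chartGen c j i) F) ∈
        maximalIdeal (Localization.AtPrime 𝔴.asIdeal) ^ μ :=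
    fun F hF hFJ => algebraMap_eval₂Hom_mem_pow_of_isNear hcY j 𝔴 χ hχ hloc hnear hF hFJ
  obtain ⟨a, ha⟩ :=
    exists_forall_mem_initialForms_eq_C_mul_pow c j hl hcq hcm 𝔴.asIdeal h𝔴' hμ hnearF
  -- shear the pair so that it becomes adapted
  obtain ⟨ã, hã⟩ := residue_surjective (R := X.presheaf.stalk (π x')) a
  have ha' : ∀ G ∈ initialForms c (stalkIdeal J (π x')) μ, ∃ c₀ : ResidueField _,
      G = MvPolynomial.C c₀ * (MvPolynomial.X l -
        MvPolynomial.C (residue _ ã) * MvPolynomial.X j) ^ μ := by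
    rw [hã]; exact ha
  have hadapt := initialForms_shiftRsop_adapted c j hl ã ha'
  have hcr₂ : IsRsopPart (shiftRsop c j fun _ => ã) := hcr.shiftRsop j ã
  have hcY₂ : Ideal.span (Set.range (shiftRsop c j fun _ => ã)) =
      stalkIdeal (vanishingIdeal Y) (π x') := by
    rw [span_range_shiftRsop, hcY]
  exact hπ.eq_of_isNear_of_isNear_curve_of_adapted hX hreg hμ hY hcr₂ hcY₂ j hl hadapt hnear
    hnear' he

/-! ## Consequence: the near point over a closed point of a curve centre is closed -/

/-- **The near point over a closed point of a curve centre is a CLOSED point** ([CoP1] Lemma 4.3 (4):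
"`x′` is uniquely determined"). `X, X′` regular and locally Noetherian, `π` the blowing up along a
regular centre `Y ⊆ {ord J = μ}` (`μ ≥ 1`) cut out at the CLOSED point `x = π x′` by a pair that is
part of a regular system of parameters, `x′` near: then `{x′}` is closed in `X′`. (A specialization
`z` of `x′` lies over `x`, so `ord_z J′ ≤ μ`; orders do not decrease under specialization, so `z` is
near; by uniqueness `z = x′`.) Companion of `IsBlowup.isClosed_singleton_of_isNear_point` (point
centres). [cite: CossartPiltant2008, Lemma 4.3 (4)] -/
theorem IsBlowup.isClosed_singleton_of_isNear_curve [IsLocallyNoetherian X]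
    [IsLocallyNoetherian X'] (hX : Scheme.IsRegular X) (hX' : Scheme.IsRegular X') {Y : Closeds X}
    (hreg : Scheme.IsRegular (vanishingIdeal Y).subscheme) (hπ : IsBlowup π (vanishingIdeal Y))
    {J : X.IdealSheafData} {μ : ℕ} (hμ : 1 ≤ μ) (hY : ∀ y ∈ (Y : Set X), idealOrder J y = μ)
    {x' : X'} (hcl : IsClosed ({π x'} : Set X))
    {c : Fin 2 → X.presheaf.stalk (π x')} (hcr : IsRsopPart c)
    (hcY : Ideal.span (Set.range c) = stalkIdeal (vanishingIdeal Y) (π x'))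
    (hnear : IsNear π (vanishingIdeal Y) J μ x') : IsClosed ({x'} : Set X') := by
  haveI := hX (π x')
  rw [← closure_subset_iff_isClosed]
  intro z hz
  have hsp : x' ⤳ z := specializes_iff_mem_closure.mpr hz
  have hπz : π z = π x' := by
    have h : π x' ⤳ π z := hsp.map π.continuous
    exact h.mem_closed hcl (Set.mem_singleton _)
  haveI : IsRegularLocalRing (X'.presheaf.stalk z) := hX' z
  have hx : π x' ∈ (Y : Set X) := by
    rw [← coe_support_vanishingIdeal, SetLike.mem_coe, mem_support_iff_stalkIdeal_le, ← hcY]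
    exact hcr.span_range_le_maximalIdeal
  have hle : idealOrder (controlledTransform π (vanishingIdeal Y) J μ) z ≤ μ := by
    have hzY : π z ∈ (Y : Set X) := by rw [hπz]; exact hx
    exact hπ.idealOrder_controlledTransform_le_of_mem hX hreg hY hzY
  have hge : (μ : ℕ∞) ≤ idealOrder (controlledTransform π (vanishingIdeal Y) J μ) z :=
    (isNear_iff.mp hnear).ge.trans (idealOrder_le_of_specializes hsp _)
  have hnz : IsNear π (vanishingIdeal Y) J μ z := isNear_iff.mpr (le_antisymm hle hge)
  exact hπ.eq_of_isNear_of_isNear_curve hX hreg hμ hY hcr hcY hnear hnz hπz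

end Literature.AlgebraicGeometry.Resolution

end
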